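import Mathlib
import Literature.Analysis.FluidPDE.VectorCalculus
import Literature.Analysis.FluidPDE.TaoAveragedNondegeneracy
import Literature.Analysis.FluidPDE.LeiZhang2011Proofs

/-!
# Tangency system + LIA decomposition ⇒ forced binormal (outer) ODE (tools stub `stub_forcedBinormalTools`, line `zero-accretion-selection`)

The algebraic glue between the LIA window assembly (`stub_liaWindowAssembly`) and the Grönwall shadowing
(`stub_outerShadowingGronwall`, p167029) in the XL core's inner-shadowing step (memo §4(b)): if a unit-speed
curve satisfies the tangency system `g • S + D = V • T` at a point (`S` the self-induction, `D = A X` the drift,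
`T` the unit tangent, `N = X″ ⊥ T`) and the self-induction decomposes as `S = L • T × N + E` (LIA with
coefficient `L` and e-uniform error `E`), then the curvature vector obeys the FORCED BINORMAL LAW
`N = (gL)⁻¹ • T × D + L⁻¹ • T × E`, so `‖N − (gL)⁻¹ • T × D‖ ≤ ‖E‖/L` — the outer ODE with forcing `O(1/L)`.
-/

noncomputable section

open Literature.Analysis.FluidPDE Literature.Analysis.FluidPDE.Tao2016
open scoped RealInnerProductSpace

namespace Summit.NavierStokesRegularity.NavierStokesRegularity.Theorems.SkeletonEquilibrium.ZeroAccretionSelection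
set_option linter.dupNamespace false

/-- BAC–CAB: `T × (T × N) = ⟪T, N⟫ • T − ⟪T, T⟫ • N`. [folklore] -/
theorem cross_cross_self_left (T N : EuclideanSpace ℝ (Fin 3)) :
    cross T (cross T N) = ⟪T, N⟫ • T - ⟪T, T⟫ • N := by
  ext i
  fin_cases i <;>
    simp [cross_apply_zero, cross_apply_one, cross_apply_two, real_inner_fin3, EuclideanSpace.real_norm_sq_eq,
      Fin.sum_univ_three] <;> ring

/-- **Forced binormal law.** From `g • S + D = V • T`, `S = L • T × N + E`, `‖T‖ = 1`, `⟪T, N⟫ = 0`, `g, L ≠ 0`: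
`N = (g * L)⁻¹ • cross T D + L⁻¹ • cross T E`. [folklore] -/
theorem forced_binormal_law {g L V : ℝ} {T N S E D : EuclideanSpace ℝ (Fin 3)} (hg : g ≠ 0) (hL : L ≠ 0)
    (hT : ‖T‖ = 1) (hTN : ⟪T, N⟫ = 0) (hS : S = L • cross T N + E) (heq : g • S + D = V • T) :
    N = (g * L)⁻¹ • cross T D + L⁻¹ • cross T E := by
  -- cross the tangency system with T: T × (gS + D) = 0
  have h0 : cross T (g • S + D) = 0 := by
    rw [heq, cross_smul_right, cross_self_eq_zero, smul_zero]
  have hTT : ⟪T, T⟫ = 1 := by rw [real_inner_self_eq_norm_sq, hT, one_pow]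
  have h1 : cross T S = -(L • N) + cross T E := by
    rw [hS, cross_add_right, cross_smul_right, cross_cross_self_left, hTN, hTT, zero_smul, one_smul, zero_sub,
      smul_neg]
  have h2 : g • (-(L • N) + cross T E) + cross T D = 0 := by
    rw [← h1, ← cross_smul_right, ← cross_add_right]; exact h0
  -- solve for N
  have h3 : (g * L) • N = cross T D + g • cross T E := by
    rw [smul_add, smul_neg] at h2
    rw [mul_smul, ← sub_eq_zero]
    have : g • L • N - (cross T D + g • cross T E) = -(-(g • L • N) + g • cross T E + cross T D) := by abel
    rw [this, h2, neg_zero]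
  have hgL : g * L ≠ 0 := mul_ne_zero hg hL
  calc N = (g * L)⁻¹ • ((g * L) • N) := by rw [smul_smul, inv_mul_cancel₀ hgL, one_smul]
    _ = (g * L)⁻¹ • (cross T D + g • cross T E) := by rw [h3]
    _ = (g * L)⁻¹ • cross T D + L⁻¹ • cross T E := by
        rw [smul_add, smul_smul]
        congr 2
        rw [mul_inv, mul_comm g⁻¹ L⁻¹, mul_assoc, inv_mul_cancel₀ hg, mul_one]

/-- **Forcing bound.** Under the same hypotheses with `0 < L`: `‖N − (g * L)⁻¹ • cross T D‖ ≤ ‖E‖ / L`. [folklore] -/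
theorem forced_binormal_bound {g L V : ℝ} {T N S E D : EuclideanSpace ℝ (Fin 3)} (hg : g ≠ 0) (hL : 0 < L)
    (hT : ‖T‖ = 1) (hTN : ⟪T, N⟫ = 0) (hS : S = L • cross T N + E) (heq : g • S + D = V • T) :
    ‖N - (g * L)⁻¹ • cross T D‖ ≤ ‖E‖ / L := by
  rw [forced_binormal_law hg hL.ne' hT hTN hS heq, add_sub_cancel_left, norm_smul, Real.norm_eq_abs,
    abs_of_pos (inv_pos.2 hL), div_eq_inv_mul]
  gcongr
  calc ‖cross T E‖ ≤ ‖T‖ * ‖E‖ := norm_cross_le_norm_mul_norm T E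
    _ = ‖E‖ := by rw [hT, one_mul]

/-- **Registered tools stub `stub_forcedBinormalTools`** (line `zero-accretion-selection`): BAC–CAB, the forced
binormal law and its forcing bound — the algebraic glue `tangency system + LIA decomposition ⇒ forced outer ODE`
between `stub_liaWindowAssembly` and `stub_outerShadowingGronwall` (memo §4(b)). [folklore] -/
theorem stub_forcedBinormalTools :
    (∀ (T N : EuclideanSpace ℝ (Fin 3)), cross T (cross T N) = ⟪T, N⟫ • T - ⟪T, T⟫ • N) ∧
    (∀ (g L V : ℝ) (T N S E D : EuclideanSpace ℝ (Fin 3)), g ≠ 0 → L ≠ 0 → ‖T‖ = 1 → ⟪T, N⟫ = 0 →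
      S = L • cross T N + E → g • S + D = V • T → N = (g * L)⁻¹ • cross T D + L⁻¹ • cross T E) ∧
    (∀ (g L V : ℝ) (T N S E D : EuclideanSpace ℝ (Fin 3)), g ≠ 0 → 0 < L → ‖T‖ = 1 → ⟪T, N⟫ = 0 →
      S = L • cross T N + E → g • S + D = V • T → ‖N - (g * L)⁻¹ • cross T D‖ ≤ ‖E‖ / L) :=
  ⟨cross_cross_self_left,
    fun _ _ _ _ _ _ _ _ hg hL hT hTN hS heq => forced_binormal_law hg hL hT hTN hS heq,
    fun _ _ _ _ _ _ _ _ hg hL hT hTN hS heq => forced_binormal_bound hg hL hT hTN hS heq⟩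

end Summit.NavierStokesRegularity.NavierStokesRegularity.Theorems.SkeletonEquilibrium.ZeroAccretionSelection
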